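import Mathlib
import Literature.Analysis.FluidPDE.TypeIAncientMild
import Literature.Analysis.FluidPDE.AxisymmetricEuler
import Literature.Analysis.FluidPDE.SwirlTransportProofs
import Literature.Analysis.FluidPDE.SelfSimilar
import Summits.NavierStokesRegularity.NavierStokesRegularity.Theorems.SymmetryModuliCountAxisymEndLiouville
import Summits.NavierStokesRegularity.NavierStokesRegularity.Theorems.CorkscrewDynamoCorkscrewProfileAngleTools
import Summits.NavierStokesRegularity.NavierStokesRegularity.Theorems.ScenarioCensusPeriodicGauge
import HarnessLib

/-!
# Census rows A9 / A13, the ROTATION-ORDER meter — LINE «rotation-order» port, part 1/3: the rotations `rotZ`, the rotation-order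
# group `stabAngles` and its closed-subgroup dichotomy, slice-level conjugation to any axis, the infinitesimal generator

Re-homed for the scenario census (typer seat ns-census-typer-1 g7; the cells are MEMBERS OF RECORD «DECIDED IN KERNEL IN FILES» of rows A9 / A13
since census v1.68 (lead g9; critic idea-crit-3 PASS + RE-STAMPs 18:37:11Z / 18:47:14Z / 18:52:59Z; ref ns-census-ref g8 PRE-CHECK ✓ §13.14 [1/6];
lit §21.20); this port makes them TREE-decided): VERBATIM PORT of ns-idea-2 LINE g11-2 «rotation-order» REV 3,
`pub/ideators/ns-idea-2/lines/rotation-order/line-rotation-order.lean` sha16 5b02128187347f27 (744 l., lean check rc 0, 0 sorry), split for the 400-line rule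
into `ScenarioCensusRotationOrder` (§0–§2: the rotations, the rotation-order group `stabAngles` and its dichotomy, slice-level conjugation, the
infinitesimal generator) → `…RotationOrderRows` (§3–§5: rows `Row_AirT` / `Row_AiaT` / `Row_AncT` / `Row_AsrT` / `Row_AsqT` + `_holds`, readings) →
`…RotationOrderAxis` (§6 / §6b: rigidity of the axis and of the scaling centre, `Row_ApaT` / `Row_AdsT` / `Row_Apa2T` + `_holds`; census KEYS).  Lean text
VERBATIM in namespace `…Theorems.ScenarioCensus.RotationOrder` (the line's `…Lines.RotationOrder` re-homed); port edits: `local notation "E3"` → `abbrev E3`,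
`[folklore]` dropped from the docstrings of the eight parameterless row `def`s (gate relocation rule), thirteen one-line docstrings added, the line's
`set_option linter.unusedVariables false` dropped (one proof lambda binds the unused `θ₀` as `_`).

No census VALUE is moved here (rows A9 / A13 keep their values; the members become TREE-decided by name); NS regularity is NOT proved; (L′) is
untouched; no summit statement is proved by this file.
-/

-- the summit and its single problem share the name `NavierStokesRegularity` (D-0017 nested layout)
set_option linter.dupNamespace false

noncomputable section

open Set Function
open Literature.Analysis.FluidPDE
open Summit.NavierStokesRegularity.NavierStokesRegularity.Theorems

namespace Summit.NavierStokesRegularity.NavierStokesRegularity.Theorems.ScenarioCensus.RotationOrder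

/-- `ℝ³` (the line's `local notation "E3"`, spelled as a reducible abbreviation for the tree). -/
abbrev E3 := EuclideanSpace ℝ (Fin 3)

/-! ## §0  Elementary facts about the rotations `rotZ` -/

/-- `θ ↦ R_θ x` is continuous. [folklore] -/
theorem continuous_rotZ_theta (x : E3) : Continuous fun θ : ℝ => rotZ θ x :=
  continuous_iff_continuousAt.2 fun θ => (hasDerivAt_rotZ x θ).continuousAt

/-- `R_{2π} = id`. [folklore] -/
theorem rotZ_two_pi (x : E3) : rotZ (2 * Real.pi) x = x := by
  ext i
  fin_cases i <;> simp [rotZ]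

/-- `R_{−θ} R_θ = id`. [folklore] -/
theorem rotZ_neg_rotZ (θ : ℝ) (x : E3) : rotZ (-θ) (rotZ θ x) = x := by
  rw [← rotZ_add, neg_add_cancel, rotZ_zero]

/-- `R_θ R_{−θ} = id`. [folklore] -/
theorem rotZ_rotZ_neg (θ : ℝ) (x : E3) : rotZ θ (rotZ (-θ) x) = x := by
  rw [← rotZ_add, add_neg_cancel, rotZ_zero]

/-- `R_θ (y + h e₃) = R_θ y + h e₃` (the rotations fix the axis pointwise and are linear). [folklore] -/
theorem rotZ_add_smul_eZ (θ h : ℝ) (y : E3) : rotZ θ (y + h • eZ) = rotZ θ y + h • eZ := by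
  ext i
  fin_cases i <;> simp [rotZ, eZ]

/-- `R_{p·2π} = id` for an integer `p`. [folklore] -/
theorem rotZ_int_mul_two_pi (p : ℤ) (x : E3) : rotZ (p * (2 * Real.pi)) x = x := by
  have hs : Real.sin (p * (2 * Real.pi)) = 0 := by
    rw [show (p : ℝ) * (2 * Real.pi) = ((2 * p : ℤ) : ℝ) * Real.pi by push_cast; ring]
    exact Real.sin_int_mul_pi _
  ext i
  fin_cases i <;> simp [rotZ, Real.cos_int_mul_two_pi, hs]

/-- The horizontal mirror `σ_h : (x₀,x₁,x₂) ↦ (x₀,x₁,−x₂)` (reflection in the plane `{x₂ = 0}`). [folklore] -/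
def reflH (x : E3) : E3 := WithLp.toLp 2 ![x 0, x 1, -x 2]

/-- `(σ_h x)₀ = x₀`. -/
@[simp] theorem reflH_apply_zero (x : E3) : reflH x 0 = x 0 := rfl
/-- `(σ_h x)₁ = x₁`. -/
@[simp] theorem reflH_apply_one (x : E3) : reflH x 1 = x 1 := rfl
/-- `(σ_h x)₂ = −x₂`. -/
@[simp] theorem reflH_apply_two (x : E3) : reflH x 2 = -x 2 := rfl

/-- `σ_h² = id`. [folklore] -/
theorem reflH_reflH (x : E3) : reflH (reflH x) = x := by
  ext i
  fin_cases i <;> simp [reflH]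

/-- `σ_h` commutes with the rotations about the vertical axis. [folklore] -/
theorem rotZ_reflH (θ : ℝ) (x : E3) : rotZ θ (reflH x) = reflH (rotZ θ x) := by
  ext i
  fin_cases i <;> simp [rotZ, reflH]

/-- The roto-reflection `S_θ := R_θ ∘ σ_h` squares to the rotation `R_{2θ}`. [folklore] -/
theorem rotoReflection_sq (θ : ℝ) (x : E3) :
    rotZ θ (reflH (rotZ θ (reflH x))) = rotZ (2 * θ) x := by
  rw [rotZ_reflH θ x, reflH_reflH, ← rotZ_add, two_mul]

/-! ## §1  The instrument: the rotation-order group about the fixed axis `ℝ e₃` -/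

/-- **The rotation-order group** `𝔄(u)` of a space–time field on the backward slab (fixed axis
`ℝ e₃`): the angles `θ` such that EVERY slice `u(t,·)`, `t < 0`, is `R_θ`-equivariant. [folklore] -/
def stabAngles (u : ℝ → E3 → E3) : AddSubgroup ℝ where
  carrier := {θ | ∀ t < 0, ∀ x, u t (rotZ θ x) = rotZ θ (u t x)}
  zero_mem' := fun t _ x => by simp [rotZ_zero]
  add_mem' := fun {a b} ha hb t ht x => by
    show u t (rotZ (a + b) x) = rotZ (a + b) (u t x)
    rw [rotZ_add, ha t ht, hb t ht, ← rotZ_add]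
  neg_mem' := fun {a} ha t ht x => by
    show u t (rotZ (-a) x) = rotZ (-a) (u t x)
    have h1 := ha t ht (rotZ (-a) x)
    rw [rotZ_rotZ_neg] at h1
    rw [h1, rotZ_neg_rotZ]

/-- Membership in the rotation-order group, unfolded. -/
theorem mem_stabAngles_iff {u : ℝ → E3 → E3} {θ : ℝ} :
    θ ∈ stabAngles u ↔ ∀ t < 0, ∀ x, u t (rotZ θ x) = rotZ θ (u t x) := Iff.rfl

/-- `2π ∈ 𝔄(u)` always. [folklore] -/
theorem two_pi_mem_stabAngles (u : ℝ → E3 → E3) : 2 * Real.pi ∈ stabAngles u :=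
  fun t _ x => by rw [rotZ_two_pi, rotZ_two_pi]

/-- **Link to census A9e(m)**: `u` is `m`-fold symmetric about `e₃` at every `t < 0` iff
`2π/m ∈ 𝔄(u)` (definitional). [folklore] -/
theorem mFold_iff_mem_stabAngles (u : ℝ → E3 → E3) (m : ℕ) :
    (∀ t < 0, ∀ x, u t (rotZ (2 * Real.pi / m) x) = rotZ (2 * Real.pi / m) (u t x)) ↔
      2 * Real.pi / m ∈ stabAngles u := Iff.rfl

/-- `𝔄(u)` is closed when the slices are continuous. [folklore] -/
theorem isClosed_stabAngles {u : ℝ → E3 → E3} (hc : ∀ t < 0, Continuous (u t)) :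
    IsClosed (stabAngles u : Set ℝ) := by
  have e : (stabAngles u : Set ℝ) =
      ⋂ (t : ℝ) (_ : t < 0) (x : E3), {θ | u t (rotZ θ x) = rotZ θ (u t x)} := by
    ext θ
    simp only [SetLike.mem_coe, mem_stabAngles_iff, mem_iInter, mem_setOf_eq]
  rw [e]
  exact isClosed_iInter fun t => isClosed_iInter fun ht => isClosed_iInter fun x =>
    isClosed_eq ((hc t ht).comp (continuous_rotZ_theta x)) (continuous_rotZ_theta (u t x))

/-- **Closed subgroups of `ℝ` containing `2π`**: all of `ℝ`, or `(2π/m)ℤ` for some `m ≥ 1`. [folklore] -/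
theorem closedSubgroup_dichotomy (S : AddSubgroup ℝ) (hS : IsClosed (S : Set ℝ))
    (h2π : 2 * Real.pi ∈ S) :
    S = ⊤ ∨ ∃ m : ℕ, 1 ≤ m ∧ S = AddSubgroup.zmultiples (2 * Real.pi / m) := by
  by_cases hd : Dense (S : Set ℝ)
  · left
    have h1 : (S : Set ℝ) = univ := by rw [← hS.closure_eq, hd.closure_eq]
    exact AddSubgroup.coe_eq_univ.1 h1
  · right
    rw [AddSubgroup.dense_iff_ne_zmultiples] at hd
    push Not at hd
    obtain ⟨a, ha⟩ := hd
    rw [ha] at h2π ⊢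
    obtain ⟨k, hk⟩ := AddSubgroup.mem_zmultiples_iff.1 h2π
    have hπ : (0 : ℝ) < 2 * Real.pi := by positivity
    have hk0 : k ≠ 0 := by
      rintro rfl
      rw [zero_smul] at hk
      exact hπ.ne hk
    refine ⟨k.natAbs, Int.natAbs_pos.2 hk0, ?_⟩
    have hka : (k : ℝ) * a = 2 * Real.pi := by rw [← hk, zsmul_eq_mul]
    have hkR : (k : ℝ) ≠ 0 := by exact_mod_cast hk0
    have e : (k.natAbs : ℝ) = |(k : ℝ)| := by rw [Nat.cast_natAbs, Int.cast_abs]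
    rcases abs_choice (k : ℝ) with h | h
    · rw [e, h, ← hka, mul_div_cancel_left₀ a hkR]
    · rw [e, h, ← hka, show (k : ℝ) * a / -(k : ℝ) = -a by field_simp, AddSubgroup.zmultiples_neg]

/-- **ORDER DICHOTOMY for the instrument**: with continuous slices, `𝔄(u) = ℝ` (every slice
axisymmetric) or `𝔄(u) = (2π/m)ℤ` for some order `m ≥ 1`. [folklore] -/
theorem stabAngles_dichotomy {u : ℝ → E3 → E3} (hc : ∀ t < 0, Continuous (u t)) :
    stabAngles u = ⊤ ∨ ∃ m : ℕ, 1 ≤ m ∧ stabAngles u = AddSubgroup.zmultiples (2 * Real.pi / m) :=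
  closedSubgroup_dichotomy _ (isClosed_stabAngles hc) (two_pi_mem_stabAngles u)

/-- `𝔄(u) = ℝ` means every slice is axisymmetric. [folklore] -/
theorem isAxisymmetric_of_stabAngles_eq_top {u : ℝ → E3 → E3} (h : stabAngles u = ⊤) :
    ∀ t < 0, IsAxisymmetric (u t) := fun t ht θ x => by
  have hθ : θ ∈ stabAngles u := by rw [h]; trivial
  exact hθ t ht x

/-- An irrational turn and `2π` do not lie in a common cyclic subgroup. [folklore] -/
theorem not_cyclic_of_irrational {G : AddSubgroup ℝ} {p q : ℝ} (hp : p ∈ G) (hq : q ∈ G)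
    (hirr : Irrational (p / q)) : ∀ a : ℝ, G ≠ AddSubgroup.zmultiples a := by
  intro a hGa
  rw [hGa] at hp hq
  obtain ⟨m, hm⟩ := AddSubgroup.mem_zmultiples_iff.1 hp
  obtain ⟨n, hn⟩ := AddSubgroup.mem_zmultiples_iff.1 hq
  have hq0 : q ≠ 0 := by
    intro h0
    rw [h0, div_zero] at hirr
    exact not_irrational_zero hirr
  have hn0 : (n : ℝ) ≠ 0 := by
    intro h0
    rw [zsmul_eq_mul, h0, zero_mul] at hn
    exact hq0 hn.symm
  apply hirr
  refine ⟨(m : ℚ) / (n : ℚ), ?_⟩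
  rw [← hm, ← hn, zsmul_eq_mul, zsmul_eq_mul]
  push_cast
  have ha0 : a ≠ 0 := by
    intro h0
    rw [zsmul_eq_mul, h0, mul_zero] at hn
    exact hq0 hn.symm
  field_simp

/-! ## §2  Slice-level conjugation: any axis `c + L⁻¹(ℝ e₃)` -/

/-- The inverse of the identity isometry is the identity (pointwise). [folklore] -/
@[simp] theorem refl_symm_apply (x : E3) : (LinearIsometryEquiv.refl ℝ E3).symm x = x := rfl

/-- The rotation by `θ` about the axis through `c` with direction `L⁻¹ e₃`. [folklore] -/
def axisRot (c : E3) (L : E3 ≃ₗᵢ[ℝ] E3) (θ : ℝ) (x : E3) : E3 := c + L.symm (rotZ θ (L (x - c)))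

/-- For the standard axis (`c = 0`, `L = id`) this is `rotZ`. [folklore] -/
@[simp] theorem axisRot_std (θ : ℝ) (x : E3) :
    axisRot 0 (LinearIsometryEquiv.refl ℝ E3) θ x = rotZ θ x := by
  simp [axisRot]

/-- The conjugated generator `A = L⁻¹ J₃ L` of the rotations about `L⁻¹(ℝ e₃)`. [folklore] -/
def conjGen (L : E3 ≃ₗᵢ[ℝ] E3) : E3 →L[ℝ] E3 :=
  (L.symm.toLinearIsometry.toContinuousLinearMap.comp rotGenL).comp
    L.toLinearIsometry.toContinuousLinearMap

/-- `A x = L⁻¹ J₃ (L x)`. -/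
@[simp] theorem conjGen_apply (L : E3 ≃ₗᵢ[ℝ] E3) (x : E3) :
    conjGen L x = L.symm (rotGen (L x)) := by
  simp [conjGen]

/-- `A` is skew: `⟪A x, x⟫ = 0`. [folklore] -/
theorem inner_conjGen_self (L : E3 ≃ₗᵢ[ℝ] E3) (x : E3) : inner ℝ (conjGen L x) x = 0 := by
  rw [conjGen_apply]
  have h := L.inner_map_map (L.symm (rotGen (L x))) x
  rw [L.apply_symm_apply] at h
  rw [← h, inner_rotGen_self]

/-- `A ≠ 0`. [folklore] -/
theorem conjGen_ne_zero (L : E3 ≃ₗᵢ[ℝ] E3) : conjGen L ≠ 0 := by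
  intro h
  have h1 : conjGen L (L.symm (EuclideanSpace.single 0 1)) = 0 := by rw [h]; rfl
  rw [conjGen_apply, L.apply_symm_apply] at h1
  have h2 : rotGen (EuclideanSpace.single (0 : Fin 3) (1 : ℝ) : E3) = 0 := by
    simpa using congrArg L h1
  have h3 := congrArg (fun v : E3 => v 1) h2
  simp [rotGen] at h3

/-- **Slice conjugation.** If a `C¹` slice `f` is equivariant under the rotations `axisRot c L θ` for
one irrational turn `θ₀/2π ∉ ℚ`, then `f` is annihilated by the generator:
`Df(x)[A(x − c)] = A f(x)`, `A = L⁻¹ J₃ L`. [folklore] -/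
theorem infinitesimal_of_equivariant_irrational {f : E3 → E3} (hfc : Continuous f)
    (hfd : Differentiable ℝ f) (c : E3) (L : E3 ≃ₗᵢ[ℝ] E3) {θ₀ : ℝ}
    (hθ : Irrational (θ₀ / (2 * Real.pi)))
    (hsym : ∀ x, f (axisRot c L θ₀ x) = L.symm (rotZ θ₀ (L (f x)))) :
    ∀ x, fderiv ℝ f x (conjGen L (x - c)) - conjGen L (f x) = 0 := by
  -- the conjugated slice `v y = L f(c + L⁻¹ y)` is `R_{θ₀}`-equivariant, hence axisymmetric
  set v : E3 → E3 := fun y => L (f (c + L.symm y)) with hv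
  have hτc : Continuous fun y : E3 => c + L.symm y := continuous_const.add L.symm.continuous
  have hvc : Continuous v := L.continuous.comp (hfc.comp hτc)
  have hveq : ∀ y, v (rotZ θ₀ y) = rotZ θ₀ (v y) := by
    intro y
    have h1 := hsym (c + L.symm y)
    simp only [axisRot, add_sub_cancel_left, LinearIsometryEquiv.apply_symm_apply] at h1
    simp only [hv, h1, LinearIsometryEquiv.apply_symm_apply]
  have haxi : IsAxisymmetric v :=
    CorkscrewProfile.Birth.isAxisymmetric_of_equivariant_irrational hvc hθ hveq
  intro x
  set y : E3 := L (x - c) with hy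
  have hxy : c + L.symm y = x := by simp [hy]
  -- chain rule for `v = L ∘ f ∘ (c + L⁻¹ ·)` at `y`
  have hτ : HasFDerivAt (fun y : E3 => c + L.symm y)
      (L.symm.toLinearIsometry.toContinuousLinearMap) y :=
    (L.symm.toLinearIsometry.toContinuousLinearMap.hasFDerivAt).const_add c
  have hf' : HasFDerivAt f (fderiv ℝ f x) (c + L.symm y) := by
    rw [hxy]; exact (hfd x).hasFDerivAt
  have hvd : HasFDerivAt v
      (L.toLinearIsometry.toContinuousLinearMap.comp
        ((fderiv ℝ f x).comp L.symm.toLinearIsometry.toContinuousLinearMap)) y :=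
    L.toLinearIsometry.toContinuousLinearMap.hasFDerivAt.comp y (hf'.comp y hτ)
  have hJ := haxi.fderiv_rotGen hvd.differentiableAt
  rw [hvd.fderiv] at hJ
  simp only [ContinuousLinearMap.coe_comp, Function.comp_apply,
    LinearIsometry.coe_toContinuousLinearMap, LinearIsometryEquiv.coe_toLinearIsometry, hv,
    hxy] at hJ
  -- `L (Df(x)[L⁻¹ J y]) = J (L f x)`; apply `L⁻¹`
  have h2 := congrArg L.symm hJ
  rw [L.symm_apply_apply] at h2
  rw [conjGen_apply, conjGen_apply, ← hy, h2, sub_self]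

end Summit.NavierStokesRegularity.NavierStokesRegularity.Theorems.ScenarioCensus.RotationOrder

end
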